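import Summits.QuantumFields.YangMills.Theorems.BalabanUVNodesN11TopPairRoughWitness

/-! EDITION v1.1 (dag-n11-d, 2026-08-29; W2 of the FLAG №1 R2b cure): every `(hloc : (θ.Zh …).LocalLaws)` below now DISPLAYS the ONE-SCALE law it uses (`∀ Y ω ω′, ω k = ω′ k → ζ0 k Y ω = ζ0 k Y ω′`) and the «row by name» corollaries take it as `hzh`; the proviso row `zhLocal` is re-typed IN PLACE to print's two-scale law ([III] (3.1)–(3.4) pp.264–267); the located degeneracy holds at every θ whose step-1 residual is one-scale (e.g. the record's uniform `ζ0`).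
# DAG node N11 — THE MAIN TERM AT EVERY PARAMETER WHOSE STEP-1 RESIDUAL IS ONE-SCALE (`hzh`, displayed): under a ONE-SCALE locality law 11a reads the new-side prefactor `ζ_0(∅)` of the top pair at the BASE
# configuration, whose level-`0` component is the unit field for EVERY coarse field `V′` — so the prefactor is a `V′`-INDEPENDENT CONSTANT times a positive exponential at
# EVERY `θ` obeying that law (since W2∕T1′ the proviso row `zhLocal` is print's TWO-SCALE law and does NOT imply it), and g18's rough-set test (old side a.e. zero on the non-null rough part of the support) makes the top pair's (O3′) clause, hence the first
# 𝐓-law `TLaw₁₃CoPH θ p 0`, hold ONLY WITH A VANISHING MAIN-TERM 𝐓-SLOT — at `SU(2)` under the numerics guards alone (count-neutral, LOCATED)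

HEADER — WORK-UNIT METADATA.  Cell `pub-ymgap`, YM-PLAN Track A (HUMAN RULING D-0062), seat `pub-ymgap-dag-n11-d` (g19; N11 [B14], s2), route `BalabanUVNodes`, item K1⁹ =
stmt-QuantumFields-27364 (helper lane, `--kind proof --supports 27364 --as helper`, count-neutral).  [III] = [Balaban1988Convergent], [B7] = [Balaban1985Averaging], [I] =
[Balaban1987RG1].  Over this seat's g18 `…N11TopPairRoughSet` ∕ `…N11TopPairRoughWitness` (the test: ★★★ `top_prefactor_ae_zero_on_rough_of_O3` at EVERY `θ`, the non-nullity of the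
rough all-(3.2)-small coarse fields `rough_support_ne_zero_of_lt_dist1`, dag-n07-e's `su2_dist1_surj`), `…N11TopChildTStep.sect2Slot_top_eq_exp`, `…N11OmegaTopAtRePinH.baseCfg_fst_of_ne`,
g3's `Node00.TkNoExpansionStepZero.chiAW_empty_empty`, node00-def-T's RECORD 13 v1.7 `H` (`Node00/Record13CoPH`: `Stage13HParams.Zh`, `WtOfRecord₁₃H`, rows `zhLocal` of
`Provisos₁₃CoPH` ∕ `Provisos₁₃SepCoPH`, `TLaw₁₃CoPH`, `tLaw₁₃CoPH_iff`) and 12b's `TkResidualW.LocalLaws` (`Node00/Record12`).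

WHY THIS FILE.  g18's ★★★★ `…TopPairRoughWitness.rePinH_main_term_absent_of_O3_su2` read the top pair's new-side prefactor `ζ_0(∅)(base₁V′)·w_0(𝕋,∅,∅)(base₁V′)` at THIS SEAT's pins
(`rePinH θ`: the constant `c₀`) while the OLD side vanishes for a.e. ROUGH `V′` of the (non-null) support.  The constancy is NOT a feature of the pin: under a ONE-SCALE locality law
`hzh : ω j = ω′ j → ζ0 j Y ω = ζ0 j Y ω′` of the step-1 residual (DISPLAYED in every statement below; it WAS 12b's row `zhLocal` of `Provisos₁₃CoPH` ∕ `Provisos₁₃SepCoPH` until W2∕T1′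
2026-08-29 re-typed that row to print's TWO-SCALE law, which does NOT imply `hzh`) 11a reads generation `k` of an Ω-top child at `baseCfg (k+1) V′`, whose level-`k` component is
`((fun _ => 1), 0)` WHATEVER `V′` is.  Hence at EVERY `θ` obeying `hzh`, `ζ_0(∅)(base₁V′) = ζ_0(∅)(base₁ 1) =: c` (§1), the prefactor is `c · e^{−½quad_0(𝕋)(base₁V′)}` (§2), g18's
test reads «(O3′) at the top pair ⇒ `slotT ≡ 0 ∨ c = 0 ∨ {χ₁ ≠ 0 ∧ rough}` null» (§3), the last member is refuted by ONE group element beyond the threshold — at `SU(2)` by the guards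
alone (§3–§4) — and the first 𝐓-law `TLaw₁₃CoPH θ p 0` serves the top pair only with `𝐓ρ₀(𝕋,𝕋) ≡ 0` or `= 0` a.e. on its support (§5): THE MAIN TERM OF [III] THM 1 ([I] Thm 1 (0.22)–(0.25),
g18 `…TopPairNewAction.firstStep_O3_top_iff_explicit`) IS CARRIED BY NO `θ : Stage13HParams F 2` WHOSE STEP-1 RESIDUAL OBEYS `hzh` (NOT a statement about K1⁹'s provisos since W2).

WHAT THIS FILE PROVES (0 `def`, 0 `sorry`, standard axioms).  §1 `baseCfg_apply_of_ne` · `WtOfRecord₁₃H_ζ_eq_ζ0` (`rfl`) · ★ `WtOfRecord₁₃H_ζ_baseCfg_eq_of_localLaws` (EVERY level `k`,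
EVERY region `Y`: `ζ_k(Y)(base_{k+1}V′)` does not read `V′`) · `WtOfRecord₁₃H_w_univ_empty_empty` (`w_j(𝕋,∅,∅)(ω) = e^{−½quad_j(𝕋)(ω)}`).  §2 ★★ `top_prefactor_eq_of_localLaws` ·
★★ `top_prefactor_eq_zero_iff_of_localLaws` · ★★ `sect2Slot_top_pair_eq_of_localLaws` (new side `= c · e^{−½quad} · exp A_1`) · `sect2Slot_top_pair_eq_zero_of_localLaws`.  §3 ★★★
`top_O3_trichotomy_of_localLaws` · ★★★ `main_term_absent_of_O3_of_localLaws` · ★★★ `…_of_lt_dist1` · ★★★★ `…_su2`.  §4 (names kept for the importers; both now take `hzh`, byte-identical statements): ★★★★ `main_term_absent_of_O3_of_provisos₁₃CoPH_su2` ·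
★★★★ `main_term_absent_of_O3_of_provisos₁₃SepCoPH_su2`.  §5 ★★★★★ `tLaw₁₃CoPH_zero_top_pair_degenerate_of_lt_dist1` · ★★★★★ `tLaw₁₃CoPH_zero_top_pair_degenerate_su2` (every
`θ : Stage13HParams F 2` whose step-1 residuals obey `hzh`, under the guards: `TLaw₁₃CoPH θ p 0` ⇒ at every top pair — one exists above every level-0 history, g18
`…TopChildO3AtRecord13.exists_top_pair` — the 𝐓-slot is the zero function or vanishes a.e. on its support).

REPAIR CENSUS (readings for the type owners, NOT defect claims about print, which has neither feature): the test bites through TWO typing decisions at once — (a) def-R's UNIT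
BRANCH of the localized backgrounds (`:= 1` where (2.12) is unsolvable), making every (3.2) indicator `= 1` on strictly cube-rough coarse fields (g8 `chiFactor_eq_one_of_not_solvable`)
and so putting rough `V′` INTO the support `{χ₁(s′) ≠ 0}`; (b) 11a's reading of `ζ_k` at the base configuration together with 12b's `zeta0_local` (print's `ζ(Ω^c_{k+1})`, p.267,
reads the (3.2) functions OF THE NEW FIELD — scale `k+1`; 12a header §3 «located»).  (a′) a ZERO branch ∕ a solvability guard in the support clause empties `{χ₁ ≠ 0 ∧ rough}`;
(b′) a locality law reading `(ω j, (ω (j+1)).1)` lets `c` carry the (3.2) cut-off; (a′) alone suffices for the top pair.  This file asserts neither (memo `N11-G19-…` in HOME).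

HONEST FRAMING.  A NECESSARY-CONDITION reading on the tree's own rows and objects (count-neutral, LOCATED): nothing of Bałaban asserted or refuted; K1⁹'s `∃θ` is NOT refuted (the
zero disjunct and the other children remain; no positivity of def-T's transports is claimed — g3's dead end stays closed); N11 NOT discharged; K1⁹ NOT closed; no registered stub
touched; counts unmoved (typed 28∕28 · discharged 5∕27 · A 5∕28); NOT ℝ⁴ ∕ OS ∕ mass gap ∕ Clay.  No `sorry`, `axiom`, `def`, `instance`, `notation`.  Sources (SHAPE only): [III]
Thm 1 p.262, (2.18) p.257, (2.21)–(2.23) p.258, p.267, (3.1)–(3.5) pp.264–265, (3.25) p.270, (2.12) p.256; [B7] Prop. 2 (52)–(54) p.26, (10) p.19; [I] Thm 1 p.259, (0.4) p.253.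
-/

noncomputable section

open MeasureTheory
open scoped BigOperators Matrix.Norms.L2Operator

namespace Summit.QuantumFields.YangMills.Theorems.BalabanUVNodesN11TopPairLocalResidual

open Literature.MathematicalPhysics.QuantumFieldTheory.Balaban1983to89 T4Continuum Node00 Node00.Tk B14.Eq218Concrete B14.Sect3Decomp
open Literature.MathematicalPhysics.QuantumFieldTheory.Balaban1983to89.ExpMeanLog (deltaSU)
open B14.Eq213MaximalDomains (side)
open BalabanUVNodesN11OmegaTopAtRePinH (baseCfg_fst_of_ne)
open BalabanUVNodesN11TopChildTStep (sect2Slot_top_eq_exp)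
open BalabanUVNodesN11TopPairRoughSet (top_prefactor_ae_zero_on_rough_of_O3)
open BalabanUVNodesN11TopPairRoughWitness (rough_support_ne_zero_of_lt_dist1)
open Summit.QuantumFields.YangMills.BalabanUVNodes.N07Thm1ScaledInterfaceInstance (su2_dist1_surj)

variable {F : T4Family} {N : ℕ} [NeZero N]

/-! ## §1. The residual factor at the base configuration does not read the coarse field (under the DISPLAYED one-scale law `hloc`; NOT 12b's row since W2∕T1′) -/

section Locality

variable (θ : Stage13HParams F N) (p : B12.RunParams)

omit [NeZero N] in
/-- The base configuration `base_k(V_k)` at a level `j ≠ k` is `(1, 0)` — the SAME for every `V_k`. [cite: Balaban1988Convergent, (2.18) p.257 (bookkeeping)] -/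
theorem baseCfg_apply_of_ne {V : Type} [Zero V] {k j : ℕ} (hj : j ≠ k) (Vk Vk' : GaugeField (F.P p.K) k (SU N)) :
    (baseCfg (V := V) k Vk) j = (baseCfg (V := V) k Vk') j :=
  Prod.ext (by rw [baseCfg_fst_of_ne p (V := V) hj Vk, baseCfg_fst_of_ne p (V := V) hj Vk']) (by simp only [baseCfg_snd])

/-- The run's weight `ζ_j(Y)` for the history `s` IS the history-indexed residual's `ζ0_j(Y)` (12a″: print's `ζ`, no regularity factor; `rfl`).
[cite: Balaban1988Convergent, (2.21) p.258, p.267 (bookkeeping)] -/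
theorem WtOfRecord₁₃H_ζ_eq_ζ0 {n : ℕ} (s : SeqOfRecord F θ.ν θ.τ9.M (gOfRecord₁₃ F N θ.toStage13Params p) p.K n) (j : ℕ) (Y : Set (Site (F.P p.K) 0))
    (ω : MultiCfg (F.P p.K) (SU N) (FluctV N)) : (WtOfRecord₁₃H F N θ p s).ζ j Y ω = (θ.Zh p n s.Ω s.Λ).ζ0 j Y ω := rfl

/-- ★ **UNDER A ONE-SCALE LOCALITY LAW (`hloc`, displayed), `ζ_k(Y)` READ AT 11a's BASE CONFIGURATION `base_{k+1}(V′)` DOES NOT READ `V′`** (every level `k`, region `Y`, history `s`: the level-`k` component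
of `base_{k+1}(V′)` is `(1, 0)` for every `V′`, and `ζ0_k(Y)` reads level `k` only). [cite: Balaban1988Convergent, (2.18) p.257, (2.21) p.258, p.267, (3.2)–(3.3) p.265] -/
theorem WtOfRecord₁₃H_ζ_baseCfg_eq_of_localLaws {n k : ℕ} (s : SeqOfRecord F θ.ν θ.τ9.M (gOfRecord₁₃ F N θ.toStage13Params p) p.K n)
    (hloc : ∀ Y ω ω', ω k = ω' k → (θ.Zh p n s.Ω s.Λ).ζ0 k Y ω = (θ.Zh p n s.Ω s.Λ).ζ0 k Y ω') (Y : Set (Site (F.P p.K) 0)) (V' V'' : GaugeField (F.P p.K) (k + 1) (SU N)) :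
    (WtOfRecord₁₃H F N θ p s).ζ k Y (baseCfg (V := FluctV N) (k + 1) V') = (WtOfRecord₁₃H F N θ p s).ζ k Y (baseCfg (V := FluctV N) (k + 1) V'') :=
  hloc Y _ _ (baseCfg_apply_of_ne p (V := FluctV N) (Nat.succ_ne_self k).symm V' V'')

/-- **THE A-SIDE FACTOR OF THE EMPTY REGIONS IS A POSITIVE EXPONENTIAL** at every `θ`: `w_j(𝕋, ∅, ∅)(ω) = e^{−½ quad_j(𝕋)(ω)}` (`χ_A(∅, ∅) = 1`).
[cite: Balaban1988Convergent, (2.21) p.258, (3.21) p.269, (3.23) p.270 (bookkeeping)] -/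
theorem WtOfRecord₁₃H_w_univ_empty_empty {n : ℕ} (s : SeqOfRecord F θ.ν θ.τ9.M (gOfRecord₁₃ F N θ.toStage13Params p) p.K n) (j : ℕ)
    (ω : MultiCfg (F.P p.K) (SU N) (FluctV N)) :
    (WtOfRecord₁₃H F N θ p s).w j Set.univ ∅ ∅ ω = Real.exp (-(1 / 2 : ℝ) * (θ.Zh p n s.Ω s.Λ).quad j Set.univ ω) := by
  show chiAW F N (FluctV N) θ.ν θ.A₁ p (gOfRecord₁₃ F N θ.toStage13Params p) j ∅ ∅ ω * Real.exp (-(1 / 2 : ℝ) * (θ.Zh p n s.Ω s.Λ).quad j Set.univ ω) = _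
  rw [chiAW_empty_empty, one_mul]

end Locality

/-! ## §2. The top pair's new-side prefactor at every `θ` obeying the displayed one-scale law: a constant times a positive exponential -/

section Prefactor

variable (θ : Stage13HParams F N) (p : B12.RunParams)

/-- ★★ **THE PREFACTOR IS `c · e^{−½quad_0(𝕋)(base₁V′)}` WITH THE `V′`-INDEPENDENT CONSTANT `c = ζ_0(∅)(base₁ 1)`.** [cite: Balaban1988Convergent, (2.18) p.257, (2.21)–(2.22) p.258, p.267] -/
theorem top_prefactor_eq_of_localLaws (s' : SeqOfRecord F θ.ν θ.τ9.M (gOfRecord₁₃ F N θ.toStage13Params p) p.K 1) (hloc : ∀ Y ω ω', ω 0 = ω' 0 → (θ.Zh p 1 s'.Ω s'.Λ).ζ0 0 Y ω = (θ.Zh p 1 s'.Ω s'.Λ).ζ0 0 Y ω')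
    (V' : GaugeField (F.P p.K) 1 (SU N)) :
    (WtOfRecord₁₃H F N θ p s').ζ 0 ∅ (baseCfg (V := FluctV N) 1 V') * (WtOfRecord₁₃H F N θ p s').w 0 Set.univ ∅ ∅ (baseCfg (V := FluctV N) 1 V') =
      (WtOfRecord₁₃H F N θ p s').ζ 0 ∅ (baseCfg (V := FluctV N) 1 (fun _ => 1)) *
        Real.exp (-(1 / 2 : ℝ) * (θ.Zh p 1 s'.Ω s'.Λ).quad 0 Set.univ (baseCfg (V := FluctV N) 1 V')) := by
  rw [WtOfRecord₁₃H_ζ_baseCfg_eq_of_localLaws θ p s' hloc ∅ V' (fun _ => 1), WtOfRecord₁₃H_w_univ_empty_empty]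

/-- ★★ **… SO IT VANISHES AT ONE (EQUIVALENTLY EVERY) `V′` IFF `c = 0`.** [cite: Balaban1988Convergent, (2.21)–(2.22) p.258, p.267 (bookkeeping)] -/
theorem top_prefactor_eq_zero_iff_of_localLaws (s' : SeqOfRecord F θ.ν θ.τ9.M (gOfRecord₁₃ F N θ.toStage13Params p) p.K 1) (hloc : ∀ Y ω ω', ω 0 = ω' 0 → (θ.Zh p 1 s'.Ω s'.Λ).ζ0 0 Y ω = (θ.Zh p 1 s'.Ω s'.Λ).ζ0 0 Y ω')
    (V' : GaugeField (F.P p.K) 1 (SU N)) :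
    (WtOfRecord₁₃H F N θ p s').ζ 0 ∅ (baseCfg (V := FluctV N) 1 V') * (WtOfRecord₁₃H F N θ p s').w 0 Set.univ ∅ ∅ (baseCfg (V := FluctV N) 1 V') = 0 ↔
      (WtOfRecord₁₃H F N θ p s').ζ 0 ∅ (baseCfg (V := FluctV N) 1 (fun _ => 1)) = 0 := by
  rw [top_prefactor_eq_of_localLaws θ p s' hloc V', mul_eq_zero, or_iff_left (Real.exp_pos _).ne']

/-- ★★ **THE NEW SIDE OF THE TOP PAIR AT EVERY `θ` OBEYING THE ROW**: `sect2Slot(W^θ(s′), s′, u₁, e₁, U)(V′) = c · e^{−½quad_0(𝕋)(base₁V′)} · exp A_1(s′; u₁, (∅,0), e₁)(U(base-gauge₁V′))`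
at `s′ = (𝕋, 𝕋)`, `c = ζ_0(∅)(base₁ 1)`. [cite: Balaban1988Convergent, (2.18) p.257, (2.22)–(2.23) p.258, (3.23)–(3.25) p.270; Balaban1987RG1, Thm 1 p.259] -/
theorem sect2Slot_top_pair_eq_of_localLaws (s' : SeqOfRecord F θ.ν θ.τ9.M (gOfRecord₁₃ F N θ.toStage13Params p) p.K 1)
    (hloc : ∀ Y ω ω', ω 0 = ω' 0 → (θ.Zh p 1 s'.Ω s'.Λ).ζ0 0 Y ω = (θ.Zh p 1 s'.Ω s'.Λ).ζ0 0 Y ω') (hΩ : s'.Ω 1 = Set.univ) (hΛ : s'.Λ 1 = Set.univ)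
    (Sg : Sect2.Setting (MatA N) (SU N)) (Rz : Sect2.Residual (F.P p.K) (MatA N)) (u₁ : Sect2.TermValues (F.P p.K) (MatA N) (FluctV N) θ.τ9.M) (e₁ : ℝ) (U : BgMap F N p.K)
    (V' : GaugeField (F.P p.K) 1 (SU N)) :
    sect2Slot F N (FluctV N) p.K Sg Rz (WtOfRecord₁₃H F N θ p s') s' u₁ e₁ U V' =
      (WtOfRecord₁₃H F N θ p s').ζ 0 ∅ (baseCfg (V := FluctV N) 1 (fun _ => 1)) *
        Real.exp (-(1 / 2 : ℝ) * (θ.Zh p 1 s'.Ω s'.Λ).quad 0 Set.univ (baseCfg (V := FluctV N) 1 V')) *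
        Real.exp ((sect2ActionDataOfRecord F N (FluctV N) p.K Sg Rz s' u₁ (fun _ => ∅, fun _ => 0) e₁).action23 1
          (U (fun j => ((baseCfg (V := FluctV N) 1 V') j).1))) := by
  rw [sect2Slot_top_eq_exp (FluctV N) p.K Sg Rz (WtOfRecord₁₃H F N θ p s') s' hΩ hΛ u₁ e₁ U V', Finset.prod_range_one,
    top_prefactor_eq_of_localLaws θ p s' hloc V']

/-- **… the zero function as soon as `c = 0`** — whatever the term values, constant and background map. [cite: Balaban1988Convergent, (2.18) p.257, (3.25) p.270 (bookkeeping)] -/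
theorem sect2Slot_top_pair_eq_zero_of_localLaws (s' : SeqOfRecord F θ.ν θ.τ9.M (gOfRecord₁₃ F N θ.toStage13Params p) p.K 1)
    (hloc : ∀ Y ω ω', ω 0 = ω' 0 → (θ.Zh p 1 s'.Ω s'.Λ).ζ0 0 Y ω = (θ.Zh p 1 s'.Ω s'.Λ).ζ0 0 Y ω') (hΩ : s'.Ω 1 = Set.univ) (hΛ : s'.Λ 1 = Set.univ)
    (hc : (WtOfRecord₁₃H F N θ p s').ζ 0 ∅ (baseCfg (V := FluctV N) 1 (fun _ => 1)) = 0)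
    (Sg : Sect2.Setting (MatA N) (SU N)) (Rz : Sect2.Residual (F.P p.K) (MatA N)) (u₁ : Sect2.TermValues (F.P p.K) (MatA N) (FluctV N) θ.τ9.M) (e₁ : ℝ) (U : BgMap F N p.K) :
    sect2Slot F N (FluctV N) p.K Sg Rz (WtOfRecord₁₃H F N θ p s') s' u₁ e₁ U = 0 := by
  funext V'
  rw [sect2Slot_top_pair_eq_of_localLaws θ p s' hloc hΩ hΛ Sg Rz u₁ e₁ U V', hc, zero_mul, zero_mul]
  rfl

end Prefactor

/-! ## §3. The test at every `θ` obeying the displayed one-scale law -/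

section Test

variable (θ : Stage13HParams F N) (p : B12.RunParams)

/-- ★★★ **THE TRICHOTOMY AT EVERY `θ` OBEYING THE DISPLAYED ONE-SCALE LAW `hloc`** (Stage-13 record, `1 ≤ M`, `0 < M₂`, `0 < K`, the `α₀` guards, `ε₁η₁² + 8δ₀ ≤ α₀η₁²`): for `s′ = (𝕋, 𝕋)` and any
first-step terms `(u₁, e₁)`, (O3′) at the top pair implies `slotT_1(s′) ≡ 0 ∨ c = 0 ∨ {V′ | χ₁(s′)V′ ≠ 0 ∧ ¬PlaqSmall(2α₀(Lη₁)²) V′}` is `dV′`-null, `c = ζ_0(∅)(base₁ 1)`.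
[cite: Balaban1988Convergent, Thm 1 p.262, (3.1)–(3.5) pp.264–265, (3.25) p.270, p.267; Balaban1985Averaging, Prop. 2 (53) p.26] -/
theorem top_O3_trichotomy_of_localLaws (hM : 1 ≤ θ.τ9.M) (hM₂ : 0 < θ.ν.M₂) (hK : 0 < p.K) {α₀ : ℝ} (hα : 0 < α₀)
    (hα3 : (143 * (((((F.P p.K).d + 4 : ℕ) : ℝ)) ^ 2 / 4) ^ 2) * α₀ ≤ 1 / 3)
    (hα2 : 2 * α₀ ≤ 2 * deltaSU (Fin N) / ((((F.P p.K).d + 4) * (F.P p.K).L : ℕ) : ℝ) ^ 2)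
    (hαε : epsOfRecord θ.ν (gOfRecord₁₃ F N θ.toStage13Params p) 1 * (F.P p.K).eta 1 ^ 2 + 4 * (2 * deltaOfRecord θ.ν (gOfRecord₁₃ F N θ.toStage13Params p) 0 θ.A₁) ≤
      α₀ * (F.P p.K).eta 1 ^ 2)
    (s' : SeqOfRecord F θ.ν θ.τ9.M (gOfRecord₁₃ F N θ.toStage13Params p) p.K 1) (hloc : ∀ Y ω ω', ω 0 = ω' 0 → (θ.Zh p 1 s'.Ω s'.Λ).ζ0 0 Y ω = (θ.Zh p 1 s'.Ω s'.Λ).ζ0 0 Y ω') (hΩ : s'.Ω 1 = Set.univ) (hΛ : s'.Λ 1 = Set.univ)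
    (u₁ : Sect2.TermValues (F.P p.K) (MatA N) (FluctV N) θ.τ9.M) (e₁ : ℝ)
    (hO3 : slotsTOfRecord F N θ.ν θ.τ9 (EOfRecord₁₃ F N θ.toStage13Params) (wOfRecord₉ F N θ.toStage9Params) θ.ppSel p (gOfRecord₁₃ F N θ.toStage13Params p) 1 s' = 0 ∨
      ∀ᵐ V' ∂fieldMeasure (F.P p.K) 1 (SU N),
        chiSeqOfRecord F N θ.ν θ.τ9.M (gOfRecord₁₃ F N θ.toStage13Params p) p.K 1 s' V' ≠ 0 →
          slotsTOfRecord F N θ.ν θ.τ9 (EOfRecord₁₃ F N θ.toStage13Params) (wOfRecord₉ F N θ.toStage9Params) θ.ppSel p (gOfRecord₁₃ F N θ.toStage13Params p) 1 s' V' =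
            sect2Slot F N (FluctV N) p.K (settingOfRecord₁₃ F N θ.toStage13Params p) (θ.rzAt p s') (WtOfRecord₁₃H F N θ p s') s' u₁ e₁
              (UbgOfRecord₁₃CoP F N θ.toStage13Params p 1 s') V') :
    slotsTOfRecord F N θ.ν θ.τ9 (EOfRecord₁₃ F N θ.toStage13Params) (wOfRecord₉ F N θ.toStage9Params) θ.ppSel p (gOfRecord₁₃ F N θ.toStage13Params p) 1 s' = 0 ∨
      (WtOfRecord₁₃H F N θ p s').ζ 0 ∅ (baseCfg (V := FluctV N) 1 (fun _ => 1)) = 0 ∨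
      fieldMeasure (F.P p.K) 1 (SU N) {V' | chiSeqOfRecord F N θ.ν θ.τ9.M (gOfRecord₁₃ F N θ.toStage13Params p) p.K 1 s' V' ≠ 0 ∧
        ¬ PlaqSmall (2 * α₀ * (((F.P p.K).L : ℝ) ^ 1 * (F.P p.K).eta 1) ^ 2) V'} = 0 := by
  rcases top_prefactor_ae_zero_on_rough_of_O3 θ p hM hM₂ hK hα hα3 hα2 hαε s' hΩ hΛ u₁ e₁ hO3 with h0 | hae
  · exact Or.inl h0
  · by_cases hc : (WtOfRecord₁₃H F N θ p s').ζ 0 ∅ (baseCfg (V := FluctV N) 1 (fun _ => 1)) = 0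
    · exact Or.inr (Or.inl hc)
    · refine Or.inr (Or.inr ?_)
      have h2 : ∀ᵐ V' ∂fieldMeasure (F.P p.K) 1 (SU N), ¬ (chiSeqOfRecord F N θ.ν θ.τ9.M (gOfRecord₁₃ F N θ.toStage13Params p) p.K 1 s' V' ≠ 0 ∧
          ¬ PlaqSmall (2 * α₀ * (((F.P p.K).L : ℝ) ^ 1 * (F.P p.K).eta 1) ^ 2) V') := by
        filter_upwards [hae] with V' hV' hboth
        have h3 := hV' hboth.1 hboth.2
        rw [top_prefactor_eq_zero_iff_of_localLaws θ p s' hloc V'] at h3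
        exact hc h3
      have h4 := ae_iff.1 h2
      simp only [not_not] at h4
      exact h4

/-- ★★★ **THE MAIN TERM IS ABSENT AT EVERY `θ` OBEYING THE ROW WHEN THE ROUGH ALL-(3.2)-SMALL COARSE FIELDS ARE NON-NULL** (displayed): then (O3′) at the top pair implies that
its 𝐓-slot is the zero function or vanishes a.e. on its support (`c = 0` ⇒ the §2-form slot is the zero function, §2). [cite: Balaban1988Convergent, Thm 1 p.262, (3.1)–(3.5) pp.264–265, (3.25) p.270, p.267; Balaban1985Averaging, Prop. 2 (53) p.26] -/
theorem main_term_absent_of_O3_of_localLaws (hM : 1 ≤ θ.τ9.M) (hM₂ : 0 < θ.ν.M₂) (hK : 0 < p.K) {α₀ : ℝ} (hα : 0 < α₀)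
    (hα3 : (143 * (((((F.P p.K).d + 4 : ℕ) : ℝ)) ^ 2 / 4) ^ 2) * α₀ ≤ 1 / 3)
    (hα2 : 2 * α₀ ≤ 2 * deltaSU (Fin N) / ((((F.P p.K).d + 4) * (F.P p.K).L : ℕ) : ℝ) ^ 2)
    (hαε : epsOfRecord θ.ν (gOfRecord₁₃ F N θ.toStage13Params p) 1 * (F.P p.K).eta 1 ^ 2 + 4 * (2 * deltaOfRecord θ.ν (gOfRecord₁₃ F N θ.toStage13Params p) 0 θ.A₁) ≤
      α₀ * (F.P p.K).eta 1 ^ 2)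
    (s' : SeqOfRecord F θ.ν θ.τ9.M (gOfRecord₁₃ F N θ.toStage13Params p) p.K 1) (hloc : ∀ Y ω ω', ω 0 = ω' 0 → (θ.Zh p 1 s'.Ω s'.Λ).ζ0 0 Y ω = (θ.Zh p 1 s'.Ω s'.Λ).ζ0 0 Y ω') (hΩ : s'.Ω 1 = Set.univ) (hΛ : s'.Λ 1 = Set.univ)
    (u₁ : Sect2.TermValues (F.P p.K) (MatA N) (FluctV N) θ.τ9.M) (e₁ : ℝ)
    (hR : fieldMeasure (F.P p.K) 1 (SU N) {V' | chiSeqOfRecord F N θ.ν θ.τ9.M (gOfRecord₁₃ F N θ.toStage13Params p) p.K 1 s' V' ≠ 0 ∧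
        ¬ PlaqSmall (2 * α₀ * (((F.P p.K).L : ℝ) ^ 1 * (F.P p.K).eta 1) ^ 2) V'} ≠ 0)
    (hO3 : slotsTOfRecord F N θ.ν θ.τ9 (EOfRecord₁₃ F N θ.toStage13Params) (wOfRecord₉ F N θ.toStage9Params) θ.ppSel p (gOfRecord₁₃ F N θ.toStage13Params p) 1 s' = 0 ∨
      ∀ᵐ V' ∂fieldMeasure (F.P p.K) 1 (SU N),
        chiSeqOfRecord F N θ.ν θ.τ9.M (gOfRecord₁₃ F N θ.toStage13Params p) p.K 1 s' V' ≠ 0 →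
          slotsTOfRecord F N θ.ν θ.τ9 (EOfRecord₁₃ F N θ.toStage13Params) (wOfRecord₉ F N θ.toStage9Params) θ.ppSel p (gOfRecord₁₃ F N θ.toStage13Params p) 1 s' V' =
            sect2Slot F N (FluctV N) p.K (settingOfRecord₁₃ F N θ.toStage13Params p) (θ.rzAt p s') (WtOfRecord₁₃H F N θ p s') s' u₁ e₁
              (UbgOfRecord₁₃CoP F N θ.toStage13Params p 1 s') V') :
    slotsTOfRecord F N θ.ν θ.τ9 (EOfRecord₁₃ F N θ.toStage13Params) (wOfRecord₉ F N θ.toStage9Params) θ.ppSel p (gOfRecord₁₃ F N θ.toStage13Params p) 1 s' = 0 ∨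
      ∀ᵐ V' ∂fieldMeasure (F.P p.K) 1 (SU N),
        chiSeqOfRecord F N θ.ν θ.τ9.M (gOfRecord₁₃ F N θ.toStage13Params p) p.K 1 s' V' ≠ 0 →
          slotsTOfRecord F N θ.ν θ.τ9 (EOfRecord₁₃ F N θ.toStage13Params) (wOfRecord₉ F N θ.toStage9Params) θ.ppSel p (gOfRecord₁₃ F N θ.toStage13Params p) 1 s' V' = 0 := by
  rcases top_O3_trichotomy_of_localLaws θ p hM hM₂ hK hα hα3 hα2 hαε s' hloc hΩ hΛ u₁ e₁ hO3 with h0 | hc | hnull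
  · exact Or.inl h0
  · rcases hO3 with h0 | hid
    · exact Or.inl h0
    · refine Or.inr ?_
      filter_upwards [hid] with V' hV' hχ
      rw [hV' hχ, sect2Slot_top_pair_eq_zero_of_localLaws θ p s' hloc hΩ hΛ hc]
      rfl
  · exact absurd hnull hR

/-- ★★★ **THE MAIN TERM IS ABSENT AT EVERY `θ` OBEYING THE ROW, FROM ONE GROUP ELEMENT BEYOND THE THRESHOLD** (every `N`; `g₀ : SU N` with `2εreg < dist1 g₀`; the numerics guards
displayed): g18's `rough_support_ne_zero_of_lt_dist1` discharges `hR`. [cite: Balaban1988Convergent, Thm 1 p.262, (3.1)–(3.5) pp.264–265, (3.25) p.270, (2.12) p.256, p.267; Balaban1985Averaging, Prop. 2 (53)–(54) p.26, (10) p.19; Balaban1987RG1, (0.4) p.253] -/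
theorem main_term_absent_of_O3_of_localLaws_of_lt_dist1 (hM : 1 ≤ θ.τ9.M) (hM₂ : 0 < θ.ν.M₂) (hK : 0 < p.K) {α₀ : ℝ} (hα : 0 < α₀)
    (hα3 : (143 * (((((F.P p.K).d + 4 : ℕ) : ℝ)) ^ 2 / 4) ^ 2) * α₀ ≤ 1 / 3)
    (hα2 : 2 * α₀ ≤ 2 * deltaSU (Fin N) / ((((F.P p.K).d + 4) * (F.P p.K).L : ℕ) : ℝ) ^ 2)
    (hαε : epsOfRecord θ.ν (gOfRecord₁₃ F N θ.toStage13Params p) 1 * (F.P p.K).eta 1 ^ 2 + 4 * (2 * deltaOfRecord θ.ν (gOfRecord₁₃ F N θ.toStage13Params p) 0 θ.A₁) ≤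
      α₀ * (F.P p.K).eta 1 ^ 2)
    (hαr : 2 * α₀ * (((F.P p.K).L : ℝ) ^ 1 * (F.P p.K).eta 1) ^ 2 ≤ 2 * θ.ν.εreg)
    (hε₁ : 0 < epsOfRecord θ.ν (gOfRecord₁₃ F N θ.toStage13Params p) 1 * (F.P p.K).eta 1 ^ 2) (hmK : 1 ≤ (F.P p.K).m + (F.P p.K).K) (hε : 0 < θ.ν.εreg)
    (hε3 : (143 * (((((F.P p.K).d + 4 : ℕ) : ℝ)) ^ 2 / 4) ^ 2) * θ.ν.εreg ≤ 1 / 3)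
    (hε2 : 2 * θ.ν.εreg ≤ 2 * deltaSU (Fin N) / ((((F.P p.K).d + 4) * (F.P p.K).L : ℕ) : ℝ) ^ 2)
    (hM1 : 1 ≤ θ.ν.M₁) (h3 : 3 * side (F.P p.K).L θ.ν.M₁ 1 ≤ sideχ F θ.ν p (gOfRecord₁₃ F N θ.toStage13Params p) 0)
    (g₀ : SU N) (hg₀ : 2 * θ.ν.εreg < dist1 g₀)
    (s' : SeqOfRecord F θ.ν θ.τ9.M (gOfRecord₁₃ F N θ.toStage13Params p) p.K 1) (hloc : ∀ Y ω ω', ω 0 = ω' 0 → (θ.Zh p 1 s'.Ω s'.Λ).ζ0 0 Y ω = (θ.Zh p 1 s'.Ω s'.Λ).ζ0 0 Y ω') (hΩ : s'.Ω 1 = Set.univ) (hΛ : s'.Λ 1 = Set.univ)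
    (u₁ : Sect2.TermValues (F.P p.K) (MatA N) (FluctV N) θ.τ9.M) (e₁ : ℝ)
    (hO3 : slotsTOfRecord F N θ.ν θ.τ9 (EOfRecord₁₃ F N θ.toStage13Params) (wOfRecord₉ F N θ.toStage9Params) θ.ppSel p (gOfRecord₁₃ F N θ.toStage13Params p) 1 s' = 0 ∨
      ∀ᵐ V' ∂fieldMeasure (F.P p.K) 1 (SU N),
        chiSeqOfRecord F N θ.ν θ.τ9.M (gOfRecord₁₃ F N θ.toStage13Params p) p.K 1 s' V' ≠ 0 →
          slotsTOfRecord F N θ.ν θ.τ9 (EOfRecord₁₃ F N θ.toStage13Params) (wOfRecord₉ F N θ.toStage9Params) θ.ppSel p (gOfRecord₁₃ F N θ.toStage13Params p) 1 s' V' =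
            sect2Slot F N (FluctV N) p.K (settingOfRecord₁₃ F N θ.toStage13Params p) (θ.rzAt p s') (WtOfRecord₁₃H F N θ p s') s' u₁ e₁
              (UbgOfRecord₁₃CoP F N θ.toStage13Params p 1 s') V') :
    slotsTOfRecord F N θ.ν θ.τ9 (EOfRecord₁₃ F N θ.toStage13Params) (wOfRecord₉ F N θ.toStage9Params) θ.ppSel p (gOfRecord₁₃ F N θ.toStage13Params p) 1 s' = 0 ∨
      ∀ᵐ V' ∂fieldMeasure (F.P p.K) 1 (SU N),
        chiSeqOfRecord F N θ.ν θ.τ9.M (gOfRecord₁₃ F N θ.toStage13Params p) p.K 1 s' V' ≠ 0 →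
          slotsTOfRecord F N θ.ν θ.τ9 (EOfRecord₁₃ F N θ.toStage13Params) (wOfRecord₉ F N θ.toStage9Params) θ.ppSel p (gOfRecord₁₃ F N θ.toStage13Params p) 1 s' V' = 0 :=
  main_term_absent_of_O3_of_localLaws θ p hM hM₂ hK hα hα3 hα2 hαε s' hloc hΩ hΛ u₁ e₁
    (rough_support_ne_zero_of_lt_dist1 θ.ν θ.τ9.M p (gOfRecord₁₃ F N θ.toStage13Params p) hε₁ hmK hε hε3 hε2 hM1 hM₂ h3 g₀ hg₀ hαr s' hΩ) hO3

end Test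

/-! ## §4. The group of record `SU(2)`: guards only; the former row-keyed names, now on the displayed `hzh` -/

section SU2

variable {F : T4Family} (θ : Stage13HParams F 2) (p : B12.RunParams)

/-- ★★★★ **AT `SU(2)` THE MAIN TERM IS ABSENT AT EVERY `θ` OBEYING THE DISPLAYED ONE-SCALE LAW, GUARDS ONLY**: `SU(2)` has an element at distance `2` from `1` and [B7] Prop. 2's range forces
`2εreg < 2` at `d = 4`; so (O3′) at the top pair ⇒ its 𝐓-slot is the zero function or vanishes a.e. on its support.
[cite: Balaban1988Convergent, Thm 1 p.262, (3.1)–(3.5) pp.264–265, (3.25) p.270, (2.12) p.256, p.267; Balaban1985Averaging, Prop. 2 (52)–(54) p.26, (10) p.19; Balaban1987RG1, (0.4) p.253] -/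
theorem main_term_absent_of_O3_of_localLaws_su2 (hM : 1 ≤ θ.τ9.M) (hM₂ : 0 < θ.ν.M₂) (hK : 0 < p.K) {α₀ : ℝ} (hα : 0 < α₀)
    (hα3 : (143 * (((((F.P p.K).d + 4 : ℕ) : ℝ)) ^ 2 / 4) ^ 2) * α₀ ≤ 1 / 3)
    (hα2 : 2 * α₀ ≤ 2 * deltaSU (Fin 2) / ((((F.P p.K).d + 4) * (F.P p.K).L : ℕ) : ℝ) ^ 2)
    (hαε : epsOfRecord θ.ν (gOfRecord₁₃ F 2 θ.toStage13Params p) 1 * (F.P p.K).eta 1 ^ 2 + 4 * (2 * deltaOfRecord θ.ν (gOfRecord₁₃ F 2 θ.toStage13Params p) 0 θ.A₁) ≤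
      α₀ * (F.P p.K).eta 1 ^ 2)
    (hαr : 2 * α₀ * (((F.P p.K).L : ℝ) ^ 1 * (F.P p.K).eta 1) ^ 2 ≤ 2 * θ.ν.εreg)
    (hε₁ : 0 < epsOfRecord θ.ν (gOfRecord₁₃ F 2 θ.toStage13Params p) 1 * (F.P p.K).eta 1 ^ 2) (hmK : 1 ≤ (F.P p.K).m + (F.P p.K).K) (hε : 0 < θ.ν.εreg)
    (hε3 : (143 * (((((F.P p.K).d + 4 : ℕ) : ℝ)) ^ 2 / 4) ^ 2) * θ.ν.εreg ≤ 1 / 3)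
    (hε2 : 2 * θ.ν.εreg ≤ 2 * deltaSU (Fin 2) / ((((F.P p.K).d + 4) * (F.P p.K).L : ℕ) : ℝ) ^ 2)
    (hM1 : 1 ≤ θ.ν.M₁) (h3 : 3 * side (F.P p.K).L θ.ν.M₁ 1 ≤ sideχ F θ.ν p (gOfRecord₁₃ F 2 θ.toStage13Params p) 0)
    (s' : SeqOfRecord F θ.ν θ.τ9.M (gOfRecord₁₃ F 2 θ.toStage13Params p) p.K 1) (hloc : ∀ Y ω ω', ω 0 = ω' 0 → (θ.Zh p 1 s'.Ω s'.Λ).ζ0 0 Y ω = (θ.Zh p 1 s'.Ω s'.Λ).ζ0 0 Y ω') (hΩ : s'.Ω 1 = Set.univ) (hΛ : s'.Λ 1 = Set.univ)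
    (u₁ : Sect2.TermValues (F.P p.K) (MatA 2) (FluctV 2) θ.τ9.M) (e₁ : ℝ)
    (hO3 : slotsTOfRecord F 2 θ.ν θ.τ9 (EOfRecord₁₃ F 2 θ.toStage13Params) (wOfRecord₉ F 2 θ.toStage9Params) θ.ppSel p (gOfRecord₁₃ F 2 θ.toStage13Params p) 1 s' = 0 ∨
      ∀ᵐ V' ∂fieldMeasure (F.P p.K) 1 (SU 2),
        chiSeqOfRecord F 2 θ.ν θ.τ9.M (gOfRecord₁₃ F 2 θ.toStage13Params p) p.K 1 s' V' ≠ 0 →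
          slotsTOfRecord F 2 θ.ν θ.τ9 (EOfRecord₁₃ F 2 θ.toStage13Params) (wOfRecord₉ F 2 θ.toStage9Params) θ.ppSel p (gOfRecord₁₃ F 2 θ.toStage13Params p) 1 s' V' =
            sect2Slot F 2 (FluctV 2) p.K (settingOfRecord₁₃ F 2 θ.toStage13Params p) (θ.rzAt p s') (WtOfRecord₁₃H F 2 θ p s') s' u₁ e₁
              (UbgOfRecord₁₃CoP F 2 θ.toStage13Params p 1 s') V') :
    slotsTOfRecord F 2 θ.ν θ.τ9 (EOfRecord₁₃ F 2 θ.toStage13Params) (wOfRecord₉ F 2 θ.toStage9Params) θ.ppSel p (gOfRecord₁₃ F 2 θ.toStage13Params p) 1 s' = 0 ∨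
      ∀ᵐ V' ∂fieldMeasure (F.P p.K) 1 (SU 2),
        chiSeqOfRecord F 2 θ.ν θ.τ9.M (gOfRecord₁₃ F 2 θ.toStage13Params p) p.K 1 s' V' ≠ 0 →
          slotsTOfRecord F 2 θ.ν θ.τ9 (EOfRecord₁₃ F 2 θ.toStage13Params) (wOfRecord₉ F 2 θ.toStage9Params) θ.ppSel p (gOfRecord₁₃ F 2 θ.toStage13Params p) 1 s' V' = 0 := by
  obtain ⟨g₀, hg₀⟩ := su2_dist1_surj 2 zero_le_two le_rfl
  have hd : (F.P p.K).d = 4 := rfl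
  have hεlt : 2 * θ.ν.εreg < dist1 g₀ := by
    rw [hg₀]
    rw [hd] at hε3
    norm_num at hε3
    linarith
  exact main_term_absent_of_O3_of_localLaws_of_lt_dist1 θ p hM hM₂ hK hα hα3 hα2 hαε hαr hε₁ hmK hε hε3 hε2 hM1 h3 g₀ hεlt s' hloc hΩ hΛ u₁ e₁ hO3

/-- ★★★★ **FORMERLY THE ROW BY NAME `Provisos₁₃CoPH` (name kept for the importers); SINCE W2∕T1′ 2026-08-29 THE HYPOTHESIS ACTUALLY TAKEN IS THE DISPLAYED ONE-SCALE LAW `hzh` of the step-1 residuals — the proviso row `zhLocal` is now print's two-scale law and does NOT imply it; NO proviso structure is read; statement and proof are BYTE-IDENTICAL to `main_term_absent_of_O3_of_provisos₁₃SepCoPH_su2` below (two names, one theorem)**: for every `θ : Stage13HParams F 2` whose step-1 residuals obey `hzh`, under the numerics guards, (O3′) at the top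
pair ⇒ its 𝐓-slot is the zero function or vanishes a.e. on its support. [cite: Balaban1988Convergent, Thm 1 p.262, (3.1)–(3.5) pp.264–265, (3.25) p.270, p.267; Balaban1985Averaging, Prop. 2 (52)–(54) p.26] -/
theorem main_term_absent_of_O3_of_provisos₁₃CoPH_su2 (hzh : ∀ (Ω Λ : ℕ → Set (Site (F.P p.K) 0)) Y ω ω', ω 0 = ω' 0 → (θ.Zh p 1 Ω Λ).ζ0 0 Y ω = (θ.Zh p 1 Ω Λ).ζ0 0 Y ω') (hM : 1 ≤ θ.τ9.M) (hM₂ : 0 < θ.ν.M₂) (hK : 0 < p.K) {α₀ : ℝ} (hα : 0 < α₀)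
    (hα3 : (143 * (((((F.P p.K).d + 4 : ℕ) : ℝ)) ^ 2 / 4) ^ 2) * α₀ ≤ 1 / 3)
    (hα2 : 2 * α₀ ≤ 2 * deltaSU (Fin 2) / ((((F.P p.K).d + 4) * (F.P p.K).L : ℕ) : ℝ) ^ 2)
    (hαε : epsOfRecord θ.ν (gOfRecord₁₃ F 2 θ.toStage13Params p) 1 * (F.P p.K).eta 1 ^ 2 + 4 * (2 * deltaOfRecord θ.ν (gOfRecord₁₃ F 2 θ.toStage13Params p) 0 θ.A₁) ≤
      α₀ * (F.P p.K).eta 1 ^ 2)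
    (hαr : 2 * α₀ * (((F.P p.K).L : ℝ) ^ 1 * (F.P p.K).eta 1) ^ 2 ≤ 2 * θ.ν.εreg)
    (hε₁ : 0 < epsOfRecord θ.ν (gOfRecord₁₃ F 2 θ.toStage13Params p) 1 * (F.P p.K).eta 1 ^ 2) (hmK : 1 ≤ (F.P p.K).m + (F.P p.K).K) (hε : 0 < θ.ν.εreg)
    (hε3 : (143 * (((((F.P p.K).d + 4 : ℕ) : ℝ)) ^ 2 / 4) ^ 2) * θ.ν.εreg ≤ 1 / 3)
    (hε2 : 2 * θ.ν.εreg ≤ 2 * deltaSU (Fin 2) / ((((F.P p.K).d + 4) * (F.P p.K).L : ℕ) : ℝ) ^ 2)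
    (hM1 : 1 ≤ θ.ν.M₁) (h3 : 3 * side (F.P p.K).L θ.ν.M₁ 1 ≤ sideχ F θ.ν p (gOfRecord₁₃ F 2 θ.toStage13Params p) 0)
    (s' : SeqOfRecord F θ.ν θ.τ9.M (gOfRecord₁₃ F 2 θ.toStage13Params p) p.K 1) (hΩ : s'.Ω 1 = Set.univ) (hΛ : s'.Λ 1 = Set.univ)
    (u₁ : Sect2.TermValues (F.P p.K) (MatA 2) (FluctV 2) θ.τ9.M) (e₁ : ℝ)
    (hO3 : slotsTOfRecord F 2 θ.ν θ.τ9 (EOfRecord₁₃ F 2 θ.toStage13Params) (wOfRecord₉ F 2 θ.toStage9Params) θ.ppSel p (gOfRecord₁₃ F 2 θ.toStage13Params p) 1 s' = 0 ∨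
      ∀ᵐ V' ∂fieldMeasure (F.P p.K) 1 (SU 2),
        chiSeqOfRecord F 2 θ.ν θ.τ9.M (gOfRecord₁₃ F 2 θ.toStage13Params p) p.K 1 s' V' ≠ 0 →
          slotsTOfRecord F 2 θ.ν θ.τ9 (EOfRecord₁₃ F 2 θ.toStage13Params) (wOfRecord₉ F 2 θ.toStage9Params) θ.ppSel p (gOfRecord₁₃ F 2 θ.toStage13Params p) 1 s' V' =
            sect2Slot F 2 (FluctV 2) p.K (settingOfRecord₁₃ F 2 θ.toStage13Params p) (θ.rzAt p s') (WtOfRecord₁₃H F 2 θ p s') s' u₁ e₁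
              (UbgOfRecord₁₃CoP F 2 θ.toStage13Params p 1 s') V') :
    slotsTOfRecord F 2 θ.ν θ.τ9 (EOfRecord₁₃ F 2 θ.toStage13Params) (wOfRecord₉ F 2 θ.toStage9Params) θ.ppSel p (gOfRecord₁₃ F 2 θ.toStage13Params p) 1 s' = 0 ∨
      ∀ᵐ V' ∂fieldMeasure (F.P p.K) 1 (SU 2),
        chiSeqOfRecord F 2 θ.ν θ.τ9.M (gOfRecord₁₃ F 2 θ.toStage13Params p) p.K 1 s' V' ≠ 0 →
          slotsTOfRecord F 2 θ.ν θ.τ9 (EOfRecord₁₃ F 2 θ.toStage13Params) (wOfRecord₉ F 2 θ.toStage9Params) θ.ppSel p (gOfRecord₁₃ F 2 θ.toStage13Params p) 1 s' V' = 0 :=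
  main_term_absent_of_O3_of_localLaws_su2 θ p hM hM₂ hK hα hα3 hα2 hαε hαr hε₁ hmK hε hε3 hε2 hM1 h3 s' (hzh s'.Ω s'.Λ) hΩ hΛ u₁ e₁ hO3

/-- ★★★★ **FORMERLY THE ROW BY NAME `Provisos₁₃SepCoPH` (K1⁹'s proviso structure; name kept for the importers); SINCE W2∕T1′ 2026-08-29 THE HYPOTHESIS ACTUALLY TAKEN IS THE DISPLAYED ONE-SCALE LAW `hzh` — the row `zhLocal` (two-scale) does NOT imply it; NO proviso is read; BYTE-IDENTICAL to `main_term_absent_of_O3_of_provisos₁₃CoPH_su2` above**: for every `θ : Stage13HParams F 2`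
whose step-1 residuals obey `hzh`, under the numerics guards, (O3′) at the top pair ⇒ its 𝐓-slot is the zero function or vanishes a.e. on its support.
[cite: Balaban1988Convergent, Thm 1 p.262, (3.1)–(3.5) pp.264–265, (3.25) p.270, p.267; Balaban1985Averaging, Prop. 2 (52)–(54) p.26] -/
theorem main_term_absent_of_O3_of_provisos₁₃SepCoPH_su2 (hzh : ∀ (Ω Λ : ℕ → Set (Site (F.P p.K) 0)) Y ω ω', ω 0 = ω' 0 → (θ.Zh p 1 Ω Λ).ζ0 0 Y ω = (θ.Zh p 1 Ω Λ).ζ0 0 Y ω') (hM : 1 ≤ θ.τ9.M) (hM₂ : 0 < θ.ν.M₂) (hK : 0 < p.K) {α₀ : ℝ} (hα : 0 < α₀)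
    (hα3 : (143 * (((((F.P p.K).d + 4 : ℕ) : ℝ)) ^ 2 / 4) ^ 2) * α₀ ≤ 1 / 3)
    (hα2 : 2 * α₀ ≤ 2 * deltaSU (Fin 2) / ((((F.P p.K).d + 4) * (F.P p.K).L : ℕ) : ℝ) ^ 2)
    (hαε : epsOfRecord θ.ν (gOfRecord₁₃ F 2 θ.toStage13Params p) 1 * (F.P p.K).eta 1 ^ 2 + 4 * (2 * deltaOfRecord θ.ν (gOfRecord₁₃ F 2 θ.toStage13Params p) 0 θ.A₁) ≤
      α₀ * (F.P p.K).eta 1 ^ 2)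
    (hαr : 2 * α₀ * (((F.P p.K).L : ℝ) ^ 1 * (F.P p.K).eta 1) ^ 2 ≤ 2 * θ.ν.εreg)
    (hε₁ : 0 < epsOfRecord θ.ν (gOfRecord₁₃ F 2 θ.toStage13Params p) 1 * (F.P p.K).eta 1 ^ 2) (hmK : 1 ≤ (F.P p.K).m + (F.P p.K).K) (hε : 0 < θ.ν.εreg)
    (hε3 : (143 * (((((F.P p.K).d + 4 : ℕ) : ℝ)) ^ 2 / 4) ^ 2) * θ.ν.εreg ≤ 1 / 3)
    (hε2 : 2 * θ.ν.εreg ≤ 2 * deltaSU (Fin 2) / ((((F.P p.K).d + 4) * (F.P p.K).L : ℕ) : ℝ) ^ 2)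
    (hM1 : 1 ≤ θ.ν.M₁) (h3 : 3 * side (F.P p.K).L θ.ν.M₁ 1 ≤ sideχ F θ.ν p (gOfRecord₁₃ F 2 θ.toStage13Params p) 0)
    (s' : SeqOfRecord F θ.ν θ.τ9.M (gOfRecord₁₃ F 2 θ.toStage13Params p) p.K 1) (hΩ : s'.Ω 1 = Set.univ) (hΛ : s'.Λ 1 = Set.univ)
    (u₁ : Sect2.TermValues (F.P p.K) (MatA 2) (FluctV 2) θ.τ9.M) (e₁ : ℝ)
    (hO3 : slotsTOfRecord F 2 θ.ν θ.τ9 (EOfRecord₁₃ F 2 θ.toStage13Params) (wOfRecord₉ F 2 θ.toStage9Params) θ.ppSel p (gOfRecord₁₃ F 2 θ.toStage13Params p) 1 s' = 0 ∨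
      ∀ᵐ V' ∂fieldMeasure (F.P p.K) 1 (SU 2),
        chiSeqOfRecord F 2 θ.ν θ.τ9.M (gOfRecord₁₃ F 2 θ.toStage13Params p) p.K 1 s' V' ≠ 0 →
          slotsTOfRecord F 2 θ.ν θ.τ9 (EOfRecord₁₃ F 2 θ.toStage13Params) (wOfRecord₉ F 2 θ.toStage9Params) θ.ppSel p (gOfRecord₁₃ F 2 θ.toStage13Params p) 1 s' V' =
            sect2Slot F 2 (FluctV 2) p.K (settingOfRecord₁₃ F 2 θ.toStage13Params p) (θ.rzAt p s') (WtOfRecord₁₃H F 2 θ p s') s' u₁ e₁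
              (UbgOfRecord₁₃CoP F 2 θ.toStage13Params p 1 s') V') :
    slotsTOfRecord F 2 θ.ν θ.τ9 (EOfRecord₁₃ F 2 θ.toStage13Params) (wOfRecord₉ F 2 θ.toStage9Params) θ.ppSel p (gOfRecord₁₃ F 2 θ.toStage13Params p) 1 s' = 0 ∨
      ∀ᵐ V' ∂fieldMeasure (F.P p.K) 1 (SU 2),
        chiSeqOfRecord F 2 θ.ν θ.τ9.M (gOfRecord₁₃ F 2 θ.toStage13Params p) p.K 1 s' V' ≠ 0 →
          slotsTOfRecord F 2 θ.ν θ.τ9 (EOfRecord₁₃ F 2 θ.toStage13Params) (wOfRecord₉ F 2 θ.toStage9Params) θ.ppSel p (gOfRecord₁₃ F 2 θ.toStage13Params p) 1 s' V' = 0 :=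
  main_term_absent_of_O3_of_localLaws_su2 θ p hM hM₂ hK hα hα3 hα2 hαε hαr hε₁ hmK hε hε3 hε2 hM1 h3 s' (hzh s'.Ω s'.Λ) hΩ hΛ u₁ e₁ hO3

end SU2

/-! ## §5. The first 𝐓-law of the record at every lawful parameter: the top pair is served only degenerately -/

section TLaw

variable {F : T4Family}

/-- ★★★★★ **EVERY `N`, ONE GROUP ELEMENT BEYOND THE THRESHOLD: `TLaw₁₃CoPH θ p 0` HOLDS AT A TOP PAIR ONLY WITH A VANISHING 𝐓-SLOT** — for every `θ : Stage13HParams F N` obeying the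
displayed one-scale law at the pair's history and the numerics guards: the law's (O3′) clause at `s′ = (𝕋, 𝕋)` is served by its own witness terms `(t s′, E s′)`, and §3 applies.
[cite: Balaban1988Convergent, Thm 1 p.262, remark p.262, Def. p.279, (3.1)–(3.5) pp.264–265, (3.25) p.270, p.267; Balaban1985Averaging, Prop. 2 (53)–(54) p.26; Balaban1987RG1, Thm 1 p.259] -/
theorem tLaw₁₃CoPH_zero_top_pair_degenerate_of_lt_dist1 {N : ℕ} [NeZero N] (θ : Stage13HParams F N) (p : B12.RunParams)
    (hM : 1 ≤ θ.τ9.M) (hM₂ : 0 < θ.ν.M₂) (hK : 0 < p.K) {α₀ : ℝ} (hα : 0 < α₀)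
    (hα3 : (143 * (((((F.P p.K).d + 4 : ℕ) : ℝ)) ^ 2 / 4) ^ 2) * α₀ ≤ 1 / 3)
    (hα2 : 2 * α₀ ≤ 2 * deltaSU (Fin N) / ((((F.P p.K).d + 4) * (F.P p.K).L : ℕ) : ℝ) ^ 2)
    (hαε : epsOfRecord θ.ν (gOfRecord₁₃ F N θ.toStage13Params p) 1 * (F.P p.K).eta 1 ^ 2 + 4 * (2 * deltaOfRecord θ.ν (gOfRecord₁₃ F N θ.toStage13Params p) 0 θ.A₁) ≤
      α₀ * (F.P p.K).eta 1 ^ 2)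
    (hαr : 2 * α₀ * (((F.P p.K).L : ℝ) ^ 1 * (F.P p.K).eta 1) ^ 2 ≤ 2 * θ.ν.εreg)
    (hε₁ : 0 < epsOfRecord θ.ν (gOfRecord₁₃ F N θ.toStage13Params p) 1 * (F.P p.K).eta 1 ^ 2) (hmK : 1 ≤ (F.P p.K).m + (F.P p.K).K) (hε : 0 < θ.ν.εreg)
    (hε3 : (143 * (((((F.P p.K).d + 4 : ℕ) : ℝ)) ^ 2 / 4) ^ 2) * θ.ν.εreg ≤ 1 / 3)
    (hε2 : 2 * θ.ν.εreg ≤ 2 * deltaSU (Fin N) / ((((F.P p.K).d + 4) * (F.P p.K).L : ℕ) : ℝ) ^ 2)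
    (hM1 : 1 ≤ θ.ν.M₁) (h3 : 3 * side (F.P p.K).L θ.ν.M₁ 1 ≤ sideχ F θ.ν p (gOfRecord₁₃ F N θ.toStage13Params p) 0)
    (g₀ : SU N) (hg₀ : 2 * θ.ν.εreg < dist1 g₀)
    (hT : TLaw₁₃CoPH F N θ p 0)
    (s' : SeqOfRecord F θ.ν θ.τ9.M (gOfRecord₁₃ F N θ.toStage13Params p) p.K 1) (hloc : ∀ Y ω ω', ω 0 = ω' 0 → (θ.Zh p 1 s'.Ω s'.Λ).ζ0 0 Y ω = (θ.Zh p 1 s'.Ω s'.Λ).ζ0 0 Y ω') (hΩ : s'.Ω 1 = Set.univ) (hΛ : s'.Λ 1 = Set.univ) :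
    slotsTOfRecord F N θ.ν θ.τ9 (EOfRecord₁₃ F N θ.toStage13Params) (wOfRecord₉ F N θ.toStage9Params) θ.ppSel p (gOfRecord₁₃ F N θ.toStage13Params p) 1 s' = 0 ∨
      ∀ᵐ V' ∂fieldMeasure (F.P p.K) 1 (SU N),
        chiSeqOfRecord F N θ.ν θ.τ9.M (gOfRecord₁₃ F N θ.toStage13Params p) p.K 1 s' V' ≠ 0 →
          slotsTOfRecord F N θ.ν θ.τ9 (EOfRecord₁₃ F N θ.toStage13Params) (wOfRecord₉ F N θ.toStage9Params) θ.ppSel p (gOfRecord₁₃ F N θ.toStage13Params p) 1 s' V' = 0 := by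
  obtain ⟨t, Ek, -, hall⟩ := (tLaw₁₃CoPH_iff F N θ p 0).1 hT
  exact main_term_absent_of_O3_of_localLaws_of_lt_dist1 θ p hM hM₂ hK hα hα3 hα2 hαε hαr hε₁ hmK hε hε3 hε2 hM1 h3 g₀ hg₀ s' hloc hΩ hΛ (t s') (Ek s')
    (hall s').2

/-- ★★★★★ **AT `SU(2)`, GUARDS ONLY, AT EVERY PARAMETER WHOSE STEP-1 RESIDUALS ARE ONE-SCALE (`hzh`, displayed — v1.1, T0′ of the FLAG №1 R2b cure; formerly read off K1⁹'s proviso row `zhLocal`): THE FIRST 𝐓-LAW OF THE RECORD SERVES EVERY TOP PAIR ONLY DEGENERATELY** — for every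
`θ : Stage13HParams F 2` whose step-1 residuals satisfy `hzh` (no proviso is read; since W2∕T1′ the row `zhLocal` does NOT imply `hzh`), under the numerics guards, `TLaw₁₃CoPH θ p 0` ⇒ at every history `s′ = (Ω₁, Λ₁) = (𝕋, 𝕋)` the 𝐓-slot `𝐓ρ₀(s′)` is the zero function or
vanishes a.e. on its support `{χ₁(s′) ≠ 0}`.  THE MAIN TERM OF [III] THM 1 IS NOT CARRIED BY ANY `θ` OBEYING `hzh` (NOT a statement about K1⁹'s provisos). [cite: Balaban1988Convergent, Thm 1 p.262, remark p.262, Def. p.279, (3.1)–(3.5) pp.264–265, (3.25) p.270, p.267, (2.12) p.256; Balaban1985Averaging, Prop. 2 (52)–(54) p.26, (10) p.19; Balaban1987RG1, Thm 1 p.259, (0.4) p.253] -/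
theorem tLaw₁₃CoPH_zero_top_pair_degenerate_su2 (θ : Stage13HParams F 2) (p : B12.RunParams) (hzh : ∀ (Ω Λ : ℕ → Set (Site (F.P p.K) 0)) Y ω ω', ω 0 = ω' 0 → (θ.Zh p 1 Ω Λ).ζ0 0 Y ω = (θ.Zh p 1 Ω Λ).ζ0 0 Y ω') 
    (hM : 1 ≤ θ.τ9.M) (hM₂ : 0 < θ.ν.M₂) (hK : 0 < p.K) {α₀ : ℝ} (hα : 0 < α₀)
    (hα3 : (143 * (((((F.P p.K).d + 4 : ℕ) : ℝ)) ^ 2 / 4) ^ 2) * α₀ ≤ 1 / 3)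
    (hα2 : 2 * α₀ ≤ 2 * deltaSU (Fin 2) / ((((F.P p.K).d + 4) * (F.P p.K).L : ℕ) : ℝ) ^ 2)
    (hαε : epsOfRecord θ.ν (gOfRecord₁₃ F 2 θ.toStage13Params p) 1 * (F.P p.K).eta 1 ^ 2 + 4 * (2 * deltaOfRecord θ.ν (gOfRecord₁₃ F 2 θ.toStage13Params p) 0 θ.A₁) ≤
      α₀ * (F.P p.K).eta 1 ^ 2)
    (hαr : 2 * α₀ * (((F.P p.K).L : ℝ) ^ 1 * (F.P p.K).eta 1) ^ 2 ≤ 2 * θ.ν.εreg)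
    (hε₁ : 0 < epsOfRecord θ.ν (gOfRecord₁₃ F 2 θ.toStage13Params p) 1 * (F.P p.K).eta 1 ^ 2) (hmK : 1 ≤ (F.P p.K).m + (F.P p.K).K) (hε : 0 < θ.ν.εreg)
    (hε3 : (143 * (((((F.P p.K).d + 4 : ℕ) : ℝ)) ^ 2 / 4) ^ 2) * θ.ν.εreg ≤ 1 / 3)
    (hε2 : 2 * θ.ν.εreg ≤ 2 * deltaSU (Fin 2) / ((((F.P p.K).d + 4) * (F.P p.K).L : ℕ) : ℝ) ^ 2)
    (hM1 : 1 ≤ θ.ν.M₁) (h3 : 3 * side (F.P p.K).L θ.ν.M₁ 1 ≤ sideχ F θ.ν p (gOfRecord₁₃ F 2 θ.toStage13Params p) 0)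
    (hT : TLaw₁₃CoPH F 2 θ p 0)
    (s' : SeqOfRecord F θ.ν θ.τ9.M (gOfRecord₁₃ F 2 θ.toStage13Params p) p.K 1) (hΩ : s'.Ω 1 = Set.univ) (hΛ : s'.Λ 1 = Set.univ) :
    slotsTOfRecord F 2 θ.ν θ.τ9 (EOfRecord₁₃ F 2 θ.toStage13Params) (wOfRecord₉ F 2 θ.toStage9Params) θ.ppSel p (gOfRecord₁₃ F 2 θ.toStage13Params p) 1 s' = 0 ∨
      ∀ᵐ V' ∂fieldMeasure (F.P p.K) 1 (SU 2),
        chiSeqOfRecord F 2 θ.ν θ.τ9.M (gOfRecord₁₃ F 2 θ.toStage13Params p) p.K 1 s' V' ≠ 0 →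
          slotsTOfRecord F 2 θ.ν θ.τ9 (EOfRecord₁₃ F 2 θ.toStage13Params) (wOfRecord₉ F 2 θ.toStage9Params) θ.ppSel p (gOfRecord₁₃ F 2 θ.toStage13Params p) 1 s' V' = 0 := by
  obtain ⟨t, Ek, -, hall⟩ := (tLaw₁₃CoPH_iff F 2 θ p 0).1 hT
  exact main_term_absent_of_O3_of_provisos₁₃SepCoPH_su2 θ p hzh hM hM₂ hK hα hα3 hα2 hαε hαr hε₁ hmK hε hε3 hε2 hM1 h3 s' hΩ hΛ (t s') (Ek s') (hall s').2

end TLaw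

end Summit.QuantumFields.YangMills.Theorems.BalabanUVNodesN11TopPairLocalResidual

end
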